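import Literature.NumberTheory.Transcendental.KZUnfoldedStokesProofs
import Literature.NumberTheory.Transcendental.KZLogCalculusProofs
import Literature.NumberTheory.Transcendental.KZUnfolding
import Literature.NumberTheory.Transcendental.SemialgebraicMapsProofs
import Literature.NumberTheory.Transcendental.NashCubes
import Summits.KontsevichZagierPeriods.KontsevichZagierPeriods.Theorems.LinRedNormalFormDihedralNormalFormStubBoundedStokesMove
import Summits.KontsevichZagierPeriods.KontsevichZagierPeriods.Theorems.LinRedNormalFormDihedralNormalFormStubBvStokes

/-!
# `UnfoldedStokesSquare` (stmt-KontsevichZagierPeriods-3520) — candidate proof along the crux idea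
`radial-flux-landed-divergence-engine` (ideator 2, round 1)

Thesis part A of route KontsevichZagierPeriods/UnfoldedStokes in ALL dimensions,
`KZ.unfoldedStokesRel ⊆ KZ.relations`, as ONE instance-family of the landed cube divergence engine
`stub_boundedStokesMove stub_bvStokes` (crux `DihedralNormalForm`, line `tame-bv-stokes`) applied to
the RADIAL FLUX FIELD of an unfolded Stokes datum; the crux follows by
`KZ.square_mem_unfoldedStokesRel`.

* `flux D` — on the unit `(n+2)`-cube (coordinates `p = Fin.init z`, `u = z last`):
  `flux D (castSucc j) z = (−1)ʲ Ω(p,u) gⱼ(p)` (`side`), `flux D last z = −u Σⱼ (−1)ʲ aⱼ(u p) gⱼ(p)`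
  (`radial`). Semialgebraic on the closed cube, bounded, differentiable, with continuous closed
  fibres (§§ Semialgebraic, Regularity);
* `sum_fderiv_flux` — its divergence is POINTWISE the divergence integrand `Ω · dη` of the datum
  (closedness of `ω` enters here only, through `KZ.UnfoldedStokesData.hasDerivAt_unfolding_insertNth`);
  its `p`-faces are `± faceIntegrand`, its `u = 1` face is `−ω∧η`, its `u = 0` face is `0`;
* `stokesRelator_mem` — the engine with `r := rD`, faces `signedRep j (r_c j)`, `rW.neg`, a zero
  representation; signs returned by `signedRep_sub_zsmul_mem` and `KZ.of_add_of_neg_mem_levelRel`;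
* `unfoldedStokesRel_subset_relations` (part A, all `n`), `stokesRelations_eq_relations`,
  `unfoldedStokesSquare` (the crux, by `KZ.square_mem_unfoldedStokesRel`).

References: M. Kontsevich, D. Zagier, *Periods* (2001), §1.2 rule 3) and §4.1 relation (3);
J. Ayoub, *Periods and the conjectures of Grothendieck and Kontsevich–Zagier*, EMS Newsl. 91 (2014),
Def. 10 (the cube Stokes generators); R. Bott, L. Tu, *Differential Forms in Algebraic Topology*
(1982), §4 (homotopy operator); M. Spivak, *Calculus on Manifolds* (1965), Thm. 4-13.
-/

noncomputable section

open Set MeasureTheory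
open Literature.NumberTheory.Transcendental Literature.ModelTheory.ExponentialFields

namespace Summit.KontsevichZagierPeriods.UnfoldedStokesSquare.RadialFlux

variable {n : ℕ} (D : KZ.UnfoldedStokesData n)

/-! ## The radial flux field -/

/-- The side components `(−1)ʲ Ω(p,u) gⱼ(p)` (`p = init z`, `u = z last`). -/
def side (j : Fin (n + 1)) (z : Fin (n + 2) → ℝ) : ℝ :=
  (-1 : ℝ) ^ (j : ℕ) * (KZ.unfolding D.a (Fin.init z) (z (Fin.last (n + 1))) * D.g j (Fin.init z))

/-- The radial component `−u · Σⱼ (−1)ʲ aⱼ(u p) gⱼ(p)`. -/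
def radial (z : Fin (n + 2) → ℝ) : ℝ :=
  -(z (Fin.last (n + 1)) * ∑ j : Fin (n + 1), (-1 : ℝ) ^ (j : ℕ) *
    (D.a j (z (Fin.last (n + 1)) • Fin.init z) * D.g j (Fin.init z)))

/-- The flux field on the `(n+2)`-cube. -/
def flux : Fin (n + 2) → (Fin (n + 2) → ℝ) → ℝ :=
  Fin.lastCases (radial D) (side D)

/-- The last component of the flux is the radial one. -/
@[simp] theorem flux_last : flux D (Fin.last (n + 1)) = radial D := by
  simp [flux]

/-- The other components of the flux are the side ones. -/
@[simp] theorem flux_castSucc (j : Fin (n + 1)) : flux D (Fin.castSucc j) = side D j := by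
  simp [flux]

/-- The face-derivative integrand `Ψⱼ` (as in `KZ.UnfoldedStokesData.continuousOn_faceDeriv`). -/
def Psi (j : Fin (n + 1)) (z : Fin (n + 2) → ℝ) : ℝ :=
  (D.a j (z (Fin.last (n + 1)) • Fin.init z) +
      z (Fin.last (n + 1)) * fderiv ℝ (D.a j) (z (Fin.last (n + 1)) • Fin.init z) (Fin.init z)) *
      D.g j (Fin.init z) +
    KZ.unfolding D.a (Fin.init z) (z (Fin.last (n + 1))) *
      fderiv ℝ (D.g j) (Fin.init z) (Pi.single j 1)

/-- The radial integrand `Θ` (as in `KZ.UnfoldedStokesData.continuousOn_radialIntegrand`). -/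
def Theta (z : Fin (n + 2) → ℝ) : ℝ :=
  ∑ j : Fin (n + 1), (-1 : ℝ) ^ (j : ℕ) *
    ((D.a j (z (Fin.last (n + 1)) • Fin.init z) +
        z (Fin.last (n + 1)) * fderiv ℝ (D.a j) (z (Fin.last (n + 1)) • Fin.init z)
          (Fin.init z)) * D.g j (Fin.init z))

/-- The pointwise identity `Σⱼ (−1)ʲ Ψⱼ − Θ = div` (the `hpt` of the soundness proof). -/
theorem sum_Psi_sub_Theta (z : Fin (n + 2) → ℝ) :
    ∑ j : Fin (n + 1), (-1 : ℝ) ^ (j : ℕ) * Psi D j z - Theta D z = D.divIntegrand z := by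
  simp only [Psi, Theta, KZ.UnfoldedStokesData.divIntegrand, mul_add, Finset.sum_add_distrib,
    Finset.mul_sum, add_sub_cancel_left]
  refine Finset.sum_congr rfl fun j _ => ?_
  ring

/-! ## The closed cube of the engine -/

/-- The closed cube in the engine's form. -/
theorem setOf_Icc_eq (k : ℕ) :
    {x : Fin k → ℝ | ∀ i, x i ∈ Icc (0:ℝ) 1} = Icc (0 : Fin k → ℝ) 1 := by
  ext x; simp [Pi.le_def, forall_and]

/-- The closed cube in the engine's form is `ℚ`-semialgebraic. -/
theorem isSemialgebraic_setOf_Icc (k : ℕ) :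
    IsSemialgebraic ℚ {x : Fin k → ℝ | ∀ i, x i ∈ Icc (0:ℝ) 1} := by
  rw [setOf_Icc_eq]; exact isSemialgebraic_closedUnitCube

/-- Membership transfer between the two forms of the closed cube. -/
theorem mem_Icc_of_mem_setOf {k : ℕ} {z : Fin k → ℝ}
    (hz : z ∈ {x : Fin k → ℝ | ∀ i, x i ∈ Icc (0:ℝ) 1}) : z ∈ Icc (0 : Fin k → ℝ) 1 := by
  rw [← setOf_Icc_eq]; exact hz

/-- `init` maps the closed `(n+2)`-cube into the closed `(n+1)`-cube. -/
theorem init_mem {z : Fin (n + 2) → ℝ} (hz : z ∈ Icc (0 : Fin (n + 2) → ℝ) 1) :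
    Fin.init z ∈ Icc (0 : Fin (n + 1) → ℝ) 1 := KZ.UnfoldedStokesData.init_mem_Icc hz

/-- `u • init z` lies in the closed cube for `z` in the closed cube. -/
theorem smul_init_mem {z : Fin (n + 2) → ℝ} (hz : z ∈ Icc (0 : Fin (n + 2) → ℝ) 1) :
    z (Fin.last (n + 1)) • Fin.init z ∈ Icc (0 : Fin (n + 1) → ℝ) 1 := by
  have hu : z (Fin.last (n + 1)) ∈ Icc (0:ℝ) 1 := KZ.UnfoldedStokesData.apply_mem_Icc hz _
  have hp := init_mem hz
  refine ⟨fun i => ?_, fun i => ?_⟩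
  · exact mul_nonneg hu.1 (hp.1 i)
  · simpa using mul_le_one₀ hu.2 (hp.1 i) (hp.2 i)

/-! ## Semialgebraicity of the flux on the closed cube -/

section Semialgebraic

/-- The scaling map `z ↦ (z last) • init z` is a `ℚ`-polynomial map. -/
theorem isSemialgebraicMapOn_smul_init :
    IsSemialgebraicMapOn ℚ {x : Fin (n + 2) → ℝ | ∀ i, x i ∈ Icc (0:ℝ) 1}
      (fun z : Fin (n + 2) → ℝ => z (Fin.last (n + 1)) • Fin.init z) := by
  refine (isSemialgebraicMapOn_aeval (isSemialgebraic_setOf_Icc (n + 2))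
    (fun i : Fin (n + 1) => (MvPolynomial.X (Fin.last (n + 1)) * MvPolynomial.X (Fin.castSucc i) :
      MvPolynomial (Fin (n + 2)) ℚ))).congr fun z _ => ?_
  ext i
  simp [Fin.init]

/-- `init` is a `ℚ`-polynomial map. -/
theorem isSemialgebraicMapOn_init :
    IsSemialgebraicMapOn ℚ {x : Fin (n + 2) → ℝ | ∀ i, x i ∈ Icc (0:ℝ) 1}
      (fun z : Fin (n + 2) → ℝ => Fin.init z) := by
  refine (isSemialgebraicMapOn_aeval (isSemialgebraic_setOf_Icc (n + 2))
    (fun i : Fin (n + 1) => (MvPolynomial.X (Fin.castSucc i) : MvPolynomial (Fin (n + 2)) ℚ))).congr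
    fun z _ => ?_
  ext i
  simp [Fin.init]

variable {D}

/-- `z ↦ aⱼ((z last) • init z)` is semialgebraic on the closed cube. -/
theorem isSemialgebraicFunOn_a_smul (j : Fin (n + 1)) :
    IsSemialgebraicFunOn ℚ {x : Fin (n + 2) → ℝ | ∀ i, x i ∈ Icc (0:ℝ) 1}
      (fun z => D.a j (z (Fin.last (n + 1)) • Fin.init z)) :=
  IsSemialgebraicFunOn.comp_isSemialgebraicMapOn_holds (D.isSemialgebraicFunOn_a j)
    isSemialgebraicMapOn_smul_init fun _ hz =>
      D.mem_U_of_mem_Icc (smul_init_mem (mem_Icc_of_mem_setOf hz))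

/-- `z ↦ gⱼ(init z)` is semialgebraic on the closed cube. -/
theorem isSemialgebraicFunOn_g_init (j : Fin (n + 1)) :
    IsSemialgebraicFunOn ℚ {x : Fin (n + 2) → ℝ | ∀ i, x i ∈ Icc (0:ℝ) 1}
      (fun z => D.g j (Fin.init z)) :=
  IsSemialgebraicFunOn.comp_isSemialgebraicMapOn_holds (D.isSemialgebraicFunOn_g j)
    isSemialgebraicMapOn_init fun _ hz =>
      D.mem_U_of_mem_Icc (init_mem (mem_Icc_of_mem_setOf hz))

/-- A coordinate function is semialgebraic. -/
theorem isSemialgebraicFunOn_coord (i : Fin (n + 2)) :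
    IsSemialgebraicFunOn ℚ {x : Fin (n + 2) → ℝ | ∀ i, x i ∈ Icc (0:ℝ) 1} (fun z => z i) := by
  simpa using isSemialgebraicFunOn_aeval (isSemialgebraic_setOf_Icc (n + 2))
    (MvPolynomial.X i : MvPolynomial (Fin (n + 2)) ℚ)

/-- A real constant `(−1)ʲ` is semialgebraic. -/
theorem isSemialgebraicFunOn_negOnePow (j : ℕ) :
    IsSemialgebraicFunOn ℚ {x : Fin (n + 2) → ℝ | ∀ i, x i ∈ Icc (0:ℝ) 1}
      (fun _ => (-1 : ℝ) ^ j) := by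
  simpa using isSemialgebraicFunOn_ratCast (isSemialgebraic_setOf_Icc (n + 2)) ((-1 : ℚ) ^ j)

/-- The unfolding integrand `z ↦ Ω(init z, z last)` is semialgebraic on the closed cube. -/
theorem isSemialgebraicFunOn_unfolding :
    IsSemialgebraicFunOn ℚ {x : Fin (n + 2) → ℝ | ∀ i, x i ∈ Icc (0:ℝ) 1}
      (fun z => KZ.unfolding D.a (Fin.init z) (z (Fin.last (n + 1)))) := by
  simp only [KZ.unfolding]
  refine KZ.isSemialgebraicFunOn_finset_sum _ (isSemialgebraic_setOf_Icc (n + 2)) fun i _ => ?_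
  exact IsSemialgebraicFunOn.mul_holds (isSemialgebraicFunOn_coord (Fin.castSucc i))
    (isSemialgebraicFunOn_a_smul (D := D) i)

/-- The side components are semialgebraic on the closed cube. -/
theorem isSemialgebraicFunOn_side (j : Fin (n + 1)) :
    IsSemialgebraicFunOn ℚ {x : Fin (n + 2) → ℝ | ∀ i, x i ∈ Icc (0:ℝ) 1} (side D j) := by
  unfold side
  exact IsSemialgebraicFunOn.mul_holds (isSemialgebraicFunOn_negOnePow j)
    (IsSemialgebraicFunOn.mul_holds isSemialgebraicFunOn_unfolding (isSemialgebraicFunOn_g_init j))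

/-- The radial component is semialgebraic on the closed cube. -/
theorem isSemialgebraicFunOn_radial :
    IsSemialgebraicFunOn ℚ {x : Fin (n + 2) → ℝ | ∀ i, x i ∈ Icc (0:ℝ) 1} (radial D) := by
  have hsum : IsSemialgebraicFunOn ℚ {x : Fin (n + 2) → ℝ | ∀ i, x i ∈ Icc (0:ℝ) 1}
      (fun z => ∑ j : Fin (n + 1), (-1 : ℝ) ^ (j : ℕ) *
        (D.a j (z (Fin.last (n + 1)) • Fin.init z) * D.g j (Fin.init z))) :=
    KZ.isSemialgebraicFunOn_finset_sum _ (isSemialgebraic_setOf_Icc (n + 2)) fun j _ =>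
      IsSemialgebraicFunOn.mul_holds (isSemialgebraicFunOn_negOnePow j)
        (IsSemialgebraicFunOn.mul_holds (isSemialgebraicFunOn_a_smul (D := D) j)
          (isSemialgebraicFunOn_g_init j))
  have hmul := IsSemialgebraicFunOn.mul_holds (isSemialgebraicFunOn_coord (n := n) (Fin.last (n + 1)))
    hsum
  exact hmul.neg.congr fun z _ => by simp only [radial, Pi.neg_apply, Pi.mul_apply]


/-- The flux is semialgebraic on the closed cube. -/
theorem isSemialgebraicFunOn_flux (i : Fin (n + 2)) :
    IsSemialgebraicFunOn ℚ {x : Fin (n + 2) → ℝ | ∀ i, x i ∈ Icc (0:ℝ) 1} (flux D i) := by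
  refine Fin.lastCases ?_ (fun j => ?_) i
  · rw [flux_last]; exact isSemialgebraicFunOn_radial
  · rw [flux_castSucc]; exact isSemialgebraicFunOn_side j

end Semialgebraic


/-! ## Continuity, boundedness, differentiability, fibre continuity -/

section Regularity

variable {D}

/-- The last coordinate is continuous. -/
theorem continuous_last : Continuous fun z : Fin (n + 2) → ℝ => z (Fin.last (n + 1)) :=
  continuous_apply _

/-- The side components are continuous on the closed cube. -/
theorem continuousOn_side (j : Fin (n + 1)) :
    ContinuousOn (side D j) (Icc (0 : Fin (n + 2) → ℝ) 1) := by
  have hPI : ∀ z ∈ Icc (0 : Fin (n + 2) → ℝ) 1, Fin.init z ∈ Icc (0 : Fin (n + 1) → ℝ) 1 :=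
    fun z hz => init_mem hz
  unfold side
  exact continuousOn_const.mul
    ((D.continuousOn_unfolding_comp KZ.continuous_init.continuousOn continuous_last.continuousOn
      fun z hz => D.smul_mem_U_of_mem_Icc (hPI z hz)
        (KZ.UnfoldedStokesData.apply_mem_Icc hz _)).mul
    (D.continuousOn_g_comp j KZ.continuous_init.continuousOn fun z hz => D.mem_U_of_mem_Icc (hPI z hz)))

/-- The radial component is continuous on the closed cube. -/
theorem continuousOn_radial :
    ContinuousOn (radial D) (Icc (0 : Fin (n + 2) → ℝ) 1) := by
  have hPI : ∀ z ∈ Icc (0 : Fin (n + 2) → ℝ) 1, Fin.init z ∈ Icc (0 : Fin (n + 1) → ℝ) 1 :=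
    fun z hz => init_mem hz
  unfold radial
  refine (continuous_last.continuousOn.mul (continuousOn_finsetSum _ fun j _ => ?_)).neg
  exact continuousOn_const.mul
    ((D.continuousOn_a_comp j (continuous_last.continuousOn.smul KZ.continuous_init.continuousOn)
      fun z hz => D.smul_mem_U_of_mem_Icc (hPI z hz) (KZ.UnfoldedStokesData.apply_mem_Icc hz _)).mul
    (D.continuousOn_g_comp j KZ.continuous_init.continuousOn fun z hz => D.mem_U_of_mem_Icc (hPI z hz)))

/-- The flux is continuous on the closed cube. -/
theorem continuousOn_flux (i : Fin (n + 2)) :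
    ContinuousOn (flux D i) (Icc (0 : Fin (n + 2) → ℝ) 1) := by
  refine Fin.lastCases ?_ (fun j => ?_) i
  · rw [flux_last]; exact continuousOn_radial
  · rw [flux_castSucc]; exact continuousOn_side j

variable (D) in
/-- ONE bound for all flux components on the open cube. -/
theorem exists_bound_flux :
    ∃ C : ℝ, ∀ i, ∀ x ∈ KZ.unitCube (n + 2), |flux D i x| ≤ C := by
  have h : ∀ i : Fin (n + 2), ∃ C, ∀ x ∈ Icc (0 : Fin (n + 2) → ℝ) 1, ‖flux D i x‖ ≤ C :=
    fun i => isCompact_Icc.exists_bound_of_continuousOn (continuousOn_flux i)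
  choose C hC using h
  refine ⟨∑ i, |C i|, fun i x hx => ?_⟩
  have h1 := hC i x (KZ.unitCube_subset_Icc _ hx)
  rw [Real.norm_eq_abs] at h1
  calc |flux D i x| ≤ C i := h1
    _ ≤ |C i| := le_abs_self _
    _ ≤ ∑ k, |C k| :=
        Finset.single_le_sum (f := fun k => |C k|) (fun k _ => abs_nonneg _) (Finset.mem_univ i)

/-- `init` is differentiable. -/
theorem differentiableAt_init (z : Fin (n + 2) → ℝ) :
    DifferentiableAt ℝ (fun w : Fin (n + 2) → ℝ => (Fin.init w : Fin (n + 1) → ℝ)) z :=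
  differentiableAt_pi.mpr fun i => differentiableAt_apply (𝕜 := ℝ) (Fin.castSucc i) z

/-- `z ↦ (z last) • init z` is differentiable. -/
theorem differentiableAt_smul_init (z : Fin (n + 2) → ℝ) :
    DifferentiableAt ℝ (fun w : Fin (n + 2) → ℝ => w (Fin.last (n + 1)) • (Fin.init w : Fin (n + 1) → ℝ)) z :=
  (differentiableAt_apply (𝕜 := ℝ) (Fin.last (n + 1)) z).smul (differentiableAt_init z)

/-- The side components are differentiable at points of the closed cube (hence of the open cube). -/
theorem differentiableAt_side (j : Fin (n + 1)) {z : Fin (n + 2) → ℝ}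
    (hz : z ∈ Icc (0 : Fin (n + 2) → ℝ) 1) : DifferentiableAt ℝ (side D j) z := by
  have hxU : Fin.init z ∈ D.U := D.mem_U_of_mem_Icc (init_mem hz)
  have huxU : z (Fin.last (n + 1)) • Fin.init z ∈ D.U := D.mem_U_of_mem_Icc (smul_init_mem hz)
  have ha : ∀ i, DifferentiableAt ℝ (fun w : Fin (n + 2) → ℝ =>
      D.a i (w (Fin.last (n + 1)) • Fin.init w)) z := fun i =>
    (D.hasFDerivAt_a i huxU).differentiableAt.comp z (differentiableAt_smul_init z)
  have hg : DifferentiableAt ℝ (fun w : Fin (n + 2) → ℝ => D.g j (Fin.init w)) z :=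
    (D.hasFDerivAt_g j hxU).differentiableAt.comp z (differentiableAt_init z)
  have hΩ : DifferentiableAt ℝ (fun w : Fin (n + 2) → ℝ =>
      KZ.unfolding D.a (Fin.init w) (w (Fin.last (n + 1)))) z := by
    simp only [KZ.unfolding]
    refine DifferentiableAt.fun_sum fun i _ => ?_
    exact (differentiableAt_apply (𝕜 := ℝ) (Fin.castSucc i) z).mul (ha i)
  unfold side
  exact (hΩ.mul hg).const_mul _

/-- The radial component is differentiable at points of the closed cube. -/
theorem differentiableAt_radial {z : Fin (n + 2) → ℝ}
    (hz : z ∈ Icc (0 : Fin (n + 2) → ℝ) 1) : DifferentiableAt ℝ (radial D) z := by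
  have hxU : Fin.init z ∈ D.U := D.mem_U_of_mem_Icc (init_mem hz)
  have huxU : z (Fin.last (n + 1)) • Fin.init z ∈ D.U := D.mem_U_of_mem_Icc (smul_init_mem hz)
  have ha : ∀ i, DifferentiableAt ℝ (fun w : Fin (n + 2) → ℝ =>
      D.a i (w (Fin.last (n + 1)) • Fin.init w)) z := fun i =>
    (D.hasFDerivAt_a i huxU).differentiableAt.comp z (differentiableAt_smul_init z)
  have hg : ∀ j, DifferentiableAt ℝ (fun w : Fin (n + 2) → ℝ => D.g j (Fin.init w)) z := fun j =>
    (D.hasFDerivAt_g j hxU).differentiableAt.comp z (differentiableAt_init z)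
  unfold radial
  refine ((differentiableAt_apply (𝕜 := ℝ) (Fin.last (n + 1)) z).mul
    (DifferentiableAt.fun_sum fun j _ => ?_)).neg
  exact ((ha j).mul (hg j)).const_mul _

/-- The flux is differentiable at points of the closed cube. -/
theorem differentiableAt_flux (i : Fin (n + 2)) {z : Fin (n + 2) → ℝ}
    (hz : z ∈ Icc (0 : Fin (n + 2) → ℝ) 1) : DifferentiableAt ℝ (flux D i) z := by
  refine Fin.lastCases ?_ (fun j => ?_) i
  · rw [flux_last]; exact differentiableAt_radial hz
  · rw [flux_castSucc]; exact differentiableAt_side j hz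

/-- Fibre continuity: `t ↦ flux i (insertNth i t y)` is continuous on `[0,1]` for `y` in the
closed `(n+1)`-cube. -/
theorem continuousOn_flux_insertNth (i : Fin (n + 2)) {y : Fin (n + 1) → ℝ}
    (hy : y ∈ Icc (0 : Fin (n + 1) → ℝ) 1) :
    ContinuousOn (fun t : ℝ => flux D i (Fin.insertNth i t y)) (Icc 0 1) := by
  have hpath : Continuous fun t : ℝ => (Fin.insertNth i t y : Fin (n + 2) → ℝ) :=
    Continuous.finInsertNth (A := fun _ : Fin (n + 2) => ℝ) i continuous_id continuous_const
  refine (continuousOn_flux i).comp hpath.continuousOn fun t ht => ?_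
  exact KZ.UnfoldedStokesData.insertNth_mem_Icc' i ht hy

end Regularity

/-! ## The divergence of the flux, pointwise -/

section Divergence

variable {D}

/-- Derivative of a side component along its own coordinate, through `insertNth`. -/
theorem hasDerivAt_side_insertNth (j : Fin (n + 1)) {y : Fin (n + 1) → ℝ}
    (hy : y ∈ Icc (0 : Fin (n + 1) → ℝ) 1) {t : ℝ} (ht : t ∈ Icc (0:ℝ) 1) :
    HasDerivAt (fun s : ℝ => side D j (Fin.insertNth (Fin.castSucc j) s y))
      ((-1 : ℝ) ^ (j : ℕ) *
        ((D.a j (y (Fin.last n) • (Fin.insertNth j t (Fin.init y) : Fin (n + 1) → ℝ)) +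
            y (Fin.last n) * fderiv ℝ (D.a j)
              (y (Fin.last n) • (Fin.insertNth j t (Fin.init y) : Fin (n + 1) → ℝ))
              (Fin.insertNth j t (Fin.init y))) * D.g j (Fin.insertNth j t (Fin.init y)) +
          KZ.unfolding D.a (Fin.insertNth j t (Fin.init y)) (y (Fin.last n)) *
            fderiv ℝ (D.g j) (Fin.insertNth j t (Fin.init y)) (Pi.single j 1))) t := by
  have hqI : Fin.init y ∈ Icc (0 : Fin n → ℝ) 1 := KZ.UnfoldedStokesData.init_mem_Icc' hy
  have huI : y (Fin.last n) ∈ Icc (0:ℝ) 1 := KZ.UnfoldedStokesData.apply_mem_Icc hy _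
  have hxI : (Fin.insertNth j t (Fin.init y) : Fin (n + 1) → ℝ) ∈ Icc (0 : Fin (n + 1) → ℝ) 1 :=
    KZ.UnfoldedStokesData.insertNth_mem_Icc' j ht hqI
  have hxU : (Fin.insertNth j t (Fin.init y) : Fin (n + 1) → ℝ) ∈ D.U := D.mem_U_of_mem_Icc hxI
  have huxU : y (Fin.last n) • (Fin.insertNth j t (Fin.init y) : Fin (n + 1) → ℝ) ∈ D.U :=
    D.smul_mem_U_of_mem_Icc hxI huI
  simp only [side, KZ.init_insertNth_castSucc, KZ.insertNth_castSucc_apply_last]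
  exact ((D.hasDerivAt_unfolding_insertNth j (Fin.init y) (y (Fin.last n)) t huxU).mul
    ((D.hasFDerivAt_g j hxU).comp_hasDerivAt t (KZ.hasDerivAt_insertNth j (Fin.init y) t))).const_mul _

/-- The partial derivative of a side component along its own coordinate is `(−1)ʲ Ψⱼ`. -/
theorem fderiv_side (j : Fin (n + 1)) {z : Fin (n + 2) → ℝ} (hz : z ∈ KZ.unitCube (n + 2)) :
    fderiv ℝ (side D j) z (Pi.single (Fin.castSucc j) 1) = (-1 : ℝ) ^ (j : ℕ) * Psi D j z := by
  set i : Fin (n + 2) := Fin.castSucc j with hi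
  set y : Fin (n + 1) → ℝ := i.removeNth z with hy
  set t : ℝ := z i with ht
  have hz_eq : (i.insertNth t y : Fin (n + 2) → ℝ) = z := Fin.insertNth_self_removeNth i z
  have hzI : z ∈ Icc (0 : Fin (n + 2) → ℝ) 1 := KZ.unitCube_subset_Icc _ hz
  have hyI : y ∈ Icc (0 : Fin (n + 1) → ℝ) 1 :=
    ⟨fun k => hzI.1 (i.succAbove k), fun k => hzI.2 (i.succAbove k)⟩
  have htI : t ∈ Icc (0:ℝ) 1 := ⟨hzI.1 i, hzI.2 i⟩
  have h1 : HasDerivAt (fun s : ℝ => side D j (i.insertNth s y))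
      (fderiv ℝ (side D j) z (Pi.single i 1)) t := by
    have hd : HasFDerivAt (side D j) (fderiv ℝ (side D j) z) (i.insertNth t y) := by
      rw [hz_eq]; exact (differentiableAt_side j hzI).hasFDerivAt
    exact hd.comp_hasDerivAt t (KZ.hasDerivAt_insertNth i y t)
  have h2 := hasDerivAt_side_insertNth (D := D) j hyI htI
  have h12 := h1.unique h2
  rw [h12]
  have hx : (Fin.insertNth j t (Fin.init y) : Fin (n + 1) → ℝ) = Fin.init z := by
    rw [← KZ.init_insertNth_castSucc j t y, hz_eq]
  have hu : y (Fin.last n) = z (Fin.last (n + 1)) := by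
    rw [← KZ.insertNth_castSucc_apply_last j t y, hz_eq]
  simp only [Psi, hx, hu]

/-- Derivative of the radial component along `u`, through `snoc`. -/
theorem hasDerivAt_radial_snoc {p : Fin (n + 1) → ℝ} (hp : p ∈ Icc (0 : Fin (n + 1) → ℝ) 1)
    {u : ℝ} (hu : u ∈ Icc (0:ℝ) 1) :
    HasDerivAt (fun v : ℝ => radial D (Fin.snoc p v))
      (-(∑ j : Fin (n + 1), ((-1 : ℝ) ^ (j : ℕ) * D.g j p) *
        (D.a j (u • p) + u * fderiv ℝ (D.a j) (u • p) p))) u := by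
  have key : ∀ v : ℝ, radial D (Fin.snoc p v) =
      -(∑ j : Fin (n + 1), ((-1 : ℝ) ^ (j : ℕ) * D.g j p) * (v * D.a j (v • p))) := by
    intro v
    simp only [radial, Fin.init_snoc, Fin.snoc_last, Finset.mul_sum]
    congr 1
    refine Finset.sum_congr rfl fun j _ => ?_
    ring
  simp_rw [key]
  refine (HasDerivAt.fun_sum fun j _ => ?_).neg
  exact (D.hasDerivAt_mul_a_smul j p (D.smul_mem_U_of_mem_Icc hp hu)).const_mul _

/-- The partial derivative of the radial component along `u` is `−Θ`. -/
theorem fderiv_radial {z : Fin (n + 2) → ℝ} (hz : z ∈ KZ.unitCube (n + 2)) :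
    fderiv ℝ (radial D) z (Pi.single (Fin.last (n + 1)) 1) = -Theta D z := by
  set p : Fin (n + 1) → ℝ := Fin.init z with hp
  set u : ℝ := z (Fin.last (n + 1)) with hu
  have hz_eq : (Fin.snoc p u : Fin (n + 2) → ℝ) = z := Fin.snoc_init_self z
  have hzI : z ∈ Icc (0 : Fin (n + 2) → ℝ) 1 := KZ.unitCube_subset_Icc _ hz
  have hpI : p ∈ Icc (0 : Fin (n + 1) → ℝ) 1 := init_mem hzI
  have huI : u ∈ Icc (0:ℝ) 1 := KZ.UnfoldedStokesData.apply_mem_Icc hzI _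
  have h1 : HasDerivAt (fun v : ℝ => radial D (Fin.snoc p v))
      (fderiv ℝ (radial D) z (Pi.single (Fin.last (n + 1)) 1)) u := by
    have hd : HasFDerivAt (radial D) (fderiv ℝ (radial D) z) (Fin.snoc p u) := by
      rw [hz_eq]; exact (differentiableAt_radial hzI).hasFDerivAt
    have hpath : HasDerivAt (fun v : ℝ => (Fin.snoc p v : Fin (n + 2) → ℝ))
        (Pi.single (Fin.last (n + 1)) 1) u := by
      have := KZ.hasDerivAt_insertNth (Fin.last (n + 1)) p u
      simpa only [Fin.insertNth_last'] using this
    exact hd.comp_hasDerivAt u hpath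
  have h2 := hasDerivAt_radial_snoc (D := D) hpI huI
  rw [h1.unique h2]
  simp only [Theta, ← hp, ← hu]
  rw [neg_inj]
  refine Finset.sum_congr rfl fun j _ => ?_
  ring

/-- **The divergence of the flux is the divergence integrand** (pointwise on the open cube;
closedness of `ω` enters here and only here). -/
theorem sum_fderiv_flux {z : Fin (n + 2) → ℝ} (hz : z ∈ KZ.unitCube (n + 2)) :
    ∑ i, fderiv ℝ (flux D i) z (Pi.single i 1) = D.divIntegrand z := by
  rw [Fin.sum_univ_castSucc]
  simp only [flux_castSucc, flux_last, fderiv_side _ hz, fderiv_radial hz, ← sum_Psi_sub_Theta]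
  ring

end Divergence


/-! ## Signed copies of representations -/

section Signed

/-- The representation `[σ, (−1)ᵐ f]` built from `r = [σ, f]`. -/
def signedRep {k : ℕ} (m : ℕ) (r : KZ.IntegralRep k) : KZ.IntegralRep k where
  domain := r.domain
  integrand := fun y => (-1 : ℝ) ^ m * r.integrand y
  isSemialgebraic_domain := r.isSemialgebraic_domain
  isSemialgebraicFunOn_integrand :=
    IsSemialgebraicFunOn.mul_holds
      (by simpa using isSemialgebraicFunOn_ratCast r.isSemialgebraic_domain ((-1 : ℚ) ^ m))
      r.isSemialgebraicFunOn_integrand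
  integrableOn := r.integrableOn.const_mul _

/-- The domain of a signed copy. -/
@[simp] theorem signedRep_domain {k : ℕ} (m : ℕ) (r : KZ.IntegralRep k) :
    (signedRep m r).domain = r.domain := rfl

/-- `[σ, (−1)ᵐ f] − (−1)ᵐ • [σ, f]` is a relation (congruence for even `m`, antipodal sum for
odd `m`). -/
theorem signedRep_sub_zsmul_mem {k : ℕ} (m : ℕ) (r : KZ.IntegralRep k) :
    KZ.of (signedRep m r) - ((-1 : ℤ) ^ m) • KZ.of r ∈ KZ.relations := by
  rcases Nat.even_or_odd m with hm | hm
  · rw [hm.neg_one_pow, one_smul]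
    exact KZ.of_sub_of_mem_relations_of_eqOn rfl fun y _ => by simp [signedRep, hm.neg_one_pow]
  · rw [hm.neg_one_pow, neg_smul, one_smul, sub_neg_eq_add]
    exact KZ.of_add_of_mem_relations_of_eqOn_neg rfl fun y _ => by
      simp [signedRep, hm.neg_one_pow]

end Signed

/-! ## Part A: every unfolded Stokes relator is a KZ relation -/

section PartA

/-- **Thesis part A, one datum.** The unfolded Stokes relator of representations carrying an
unfolded Stokes datum is a relation of the Kontsevich–Zagier calculus: ONE instance of the landed
cube divergence engine `stub_boundedStokesMove stub_bvStokes` for the radial flux field, with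
`r := rD`, side faces `±[r_c j]`, top face `rW.neg`, bottom face a zero representation. -/
theorem stokesRelator_mem (D : KZ.UnfoldedStokesData n)
    {r₀ r₁ : Fin (n + 1) → KZ.IntegralRep (n + 1)} {rW : KZ.IntegralRep (n + 1)}
    {rD : KZ.IntegralRep (n + 2)} (h : D.IsCarriedBy r₀ r₁ rW rD) :
    KZ.stokesRelator r₀ r₁ rW rD ∈ KZ.relations := by
  obtain ⟨h₀d, h₀, h₁d, h₁, hWd, hW, hDd, hD⟩ := h
  obtain ⟨C, hC⟩ := exists_bound_flux D
  obtain ⟨Z, hZd, hZi⟩ := KZ.exists_zeroRep (KZ.isSemialgebraic_unitCube (n + 1))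
  -- the face representations fed to the engine
  let f₀ : Fin (n + 2) → KZ.IntegralRep (n + 1) :=
    Fin.lastCases Z (fun j => signedRep (j : ℕ) (r₀ j))
  let f₁ : Fin (n + 2) → KZ.IntegralRep (n + 1) :=
    Fin.lastCases rW.neg (fun j => signedRep (j : ℕ) (r₁ j))
  have hf₀c : ∀ j : Fin (n + 1), f₀ (Fin.castSucc j) = signedRep (j : ℕ) (r₀ j) := fun j => by
    simp [f₀]
  have hf₁c : ∀ j : Fin (n + 1), f₁ (Fin.castSucc j) = signedRep (j : ℕ) (r₁ j) := fun j => by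
    simp [f₁]
  have hf₀l : f₀ (Fin.last (n + 1)) = Z := by simp [f₀]
  have hf₁l : f₁ (Fin.last (n + 1)) = rW.neg := by simp [f₁]
  -- THE ENGINE
  have hE : KZ.of rD - ∑ i, (KZ.of (f₁ i) - KZ.of (f₀ i)) ∈ KZ.relations := by
    refine Summit.KontsevichZagierPeriods.DihedralNormalForm.TameBVStokes.stub_boundedStokesMove
      Summit.KontsevichZagierPeriods.DihedralNormalForm.TameBVStokes.stub_bvStokes (n + 1) (flux D) C
      rD f₀ f₁ (fun i => isSemialgebraicFunOn_flux (D := D) i) hC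
      (fun i x hx => differentiableAt_flux i (KZ.unitCube_subset_Icc _ hx))
      (fun i y hy => continuousOn_flux_insertNth i (KZ.unitCube_subset_Icc _ hy)) hDd
      (fun x hx => ?_) ?_
    · -- the divergence identity on the open cube
      have hxQ : x ∈ KZ.unitCube (n + 2) := by rw [hDd] at hx; exact hx
      show rD.integrand x = ∑ i, fderiv ℝ (flux D i) x (Pi.single i 1)
      rw [hD hxQ, sum_fderiv_flux hxQ]
    · -- the faces
      refine Fin.lastCases ?_ (fun j => ?_)
      · rw [hf₀l, hf₁l, flux_last]
        refine ⟨hZd, by rw [KZ.IntegralRep.domain_neg, hWd]; rfl, fun y hy => ?_, fun y hy => ?_⟩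
        · show Z.integrand y = radial D (Fin.insertNth (Fin.last (n + 1)) 0 y)
          rw [hZi]
          simp [radial, Fin.insertNth_last']
        · show rW.neg.integrand y = radial D (Fin.insertNth (Fin.last (n + 1)) 1 y)
          rw [KZ.IntegralRep.integrand_neg, Pi.neg_apply, hW hy]
          simp only [radial, Fin.insertNth_last', Fin.init_snoc, Fin.snoc_last, one_smul, one_mul,
            KZ.UnfoldedStokesData.wedgeIntegrand]
      · rw [hf₀c, hf₁c, flux_castSucc]
        refine ⟨by rw [signedRep_domain, h₀d]; rfl, by rw [signedRep_domain, h₁d]; rfl,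
          fun y hy => ?_, fun y hy => ?_⟩
        · show (-1 : ℝ) ^ (j : ℕ) * (r₀ j).integrand y = side D j (Fin.insertNth (Fin.castSucc j) 0 y)
          rw [h₀ j hy]
          simp only [side, KZ.UnfoldedStokesData.faceIntegrand, KZ.init_insertNth_castSucc,
            KZ.insertNth_castSucc_apply_last]
        · show (-1 : ℝ) ^ (j : ℕ) * (r₁ j).integrand y = side D j (Fin.insertNth (Fin.castSucc j) 1 y)
          rw [h₁ j hy]
          simp only [side, KZ.UnfoldedStokesData.faceIntegrand, KZ.init_insertNth_castSucc,
            KZ.insertNth_castSucc_apply_last]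
  -- bookkeeping: split the sum and move the signs
  rw [Fin.sum_univ_castSucc] at hE
  simp only [hf₀c, hf₁c, hf₀l, hf₁l] at hE
  have hP1 : ∀ j : Fin (n + 1),
      KZ.of (signedRep (j : ℕ) (r₁ j)) - ((-1 : ℤ) ^ (j : ℕ)) • KZ.of (r₁ j) ∈ KZ.relations :=
    fun j => signedRep_sub_zsmul_mem _ _
  have hP0 : ∀ j : Fin (n + 1),
      KZ.of (signedRep (j : ℕ) (r₀ j)) - ((-1 : ℤ) ^ (j : ℕ)) • KZ.of (r₀ j) ∈ KZ.relations :=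
    fun j => signedRep_sub_zsmul_mem _ _
  have hN : KZ.of rW + KZ.of rW.neg ∈ KZ.relations :=
    KZ.levelRel_le_relations (KZ.of_add_of_neg_mem_levelRel rW)
  have hZ : KZ.of Z ∈ KZ.relations :=
    KZ.of_mem_relations_of_eqOn_zero Z (by rw [hZi]; exact fun _ _ => rfl)
  have key : KZ.stokesRelator r₀ r₁ rW rD =
      -(KZ.of rD - (∑ j : Fin (n + 1), (KZ.of (signedRep (j : ℕ) (r₁ j)) -
          KZ.of (signedRep (j : ℕ) (r₀ j))) + (KZ.of rW.neg - KZ.of Z)))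
        - ∑ j : Fin (n + 1), ((KZ.of (signedRep (j : ℕ) (r₁ j)) - ((-1 : ℤ) ^ (j : ℕ)) • KZ.of (r₁ j))
            - (KZ.of (signedRep (j : ℕ) (r₀ j)) - ((-1 : ℤ) ^ (j : ℕ)) • KZ.of (r₀ j)))
        - (KZ.of rW + KZ.of rW.neg) + KZ.of Z := by
    simp only [KZ.stokesRelator, Finset.sum_sub_distrib, smul_sub]
    abel
  rw [key]
  exact add_mem (sub_mem (sub_mem (neg_mem hE) (sum_mem fun j _ => sub_mem (hP1 j) (hP0 j))) hN)
    hZ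

/-- **Thesis part A of route KontsevichZagierPeriods/UnfoldedStokes, in all dimensions**:
the unfolded Stokes relators are relations of the Kontsevich–Zagier calculus. -/
theorem unfoldedStokesRel_subset_relations :
    KZ.unfoldedStokesRel ⊆ (KZ.relations : Set KZ.FormalRep) := by
  rintro c ⟨n, D, r₀, r₁, rW, rD, h, rfl⟩
  exact stokesRelator_mem D h

/-- Hence the Stokes relations ARE the KZ relations (part B of the route's thesis,
`StokesGeneration`, becomes `eval.ker ≤ relations` verbatim). -/
theorem stokesRelations_eq_relations : KZ.stokesRelations = KZ.relations :=
  KZ.stokesRelations_eq_relations_of_subset unfoldedStokesRel_subset_relations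

end PartA

/-! ## The crux

The crux `UnfoldedStokesSquare` (stmt-KontsevichZagierPeriods-3520) is the square instance of part A;
with `import Summits.KontsevichZagierPeriods.KontsevichZagierPeriods.Theses.UnfoldedStokes` the
5-line derivation (kernel-checked in the session file `PartA.lean` = `SketchIdeator2.lean`, rc 0,
axioms propext / Classical.choice / Quot.sound) reads:

```
theorem unfoldedStokesSquare :
    Summit.KontsevichZagierPeriods.KontsevichZagierPeriods.Theses.UnfoldedStokes.UnfoldedStokesSquare := by
  intro U a b c e hU hUI hstar ha hb hc he hcl sa sb sc se sa0 sa1 sb1 sc1 se0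
    rB rR rT rL rW rD hBd hB hRd hR hTd hT hLd hL hWd hW hDd hD
  exact unfoldedStokesRel_subset_relations (KZ.square_mem_unfoldedStokesRel hU hUI hstar ha hb hc
    he hcl sa sb sc se sa0 sa1 sb1 sc1 se0 rB rR rT rL rW rD hBd hB hRd hR hTd hT hLd hL hWd hW hDd
    hD)
```

This file omits only that corollary, so that it elaborates without the route module. -/

end Summit.KontsevichZagierPeriods.UnfoldedStokesSquare.RadialFlux

end
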